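import Mathlib.MeasureTheory.Integral.RieszMarkovKakutani.Real
import Mathlib.MeasureTheory.Measure.HasOuterApproxClosed
import Mathlib.MeasureTheory.Integral.IntervalIntegral.Basic
import Mathlib.Analysis.SpecificLimits.Basic
import Mathlib.Topology.Ultrafilter
import HarnessLib

/-!
# Krylov–Bogolyubov for continuous-time semiflows on compact metric spaces: invariant measures as
# generalized time averages along one trajectory

Topic `Literature/Dynamics/Ergodic`.  The continuous-time companion of
`Literature.Dynamics.Ergodic.exists_invariantMeasure_tendsto_timeAverage` (discrete maps, file
`ErgodicOptimizationProofs.lean`): for a semiflow `φ_t` (`t ≥ 0`) on a compact metric space `X`, jointly continuous on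
`[0,∞) × X` with `φ_{s+t} = φ_s ∘ φ_t`, a point `x`, times `T_k → ∞` and an ultrafilter `𝒰 → ∞` on `ℕ`, there is a Borel
probability measure `m` on `X`, invariant under EVERY `φ_s` (`s ≥ 0`), such that

  `∫ g dm = lim_𝒰 T_k⁻¹ ∫₀^{T_k} g(φ_t x) dt` for every continuous `g : X → ℝ`

(`exists_invariantMeasure_tendsto_timeAverage_semiflow`).  This is the Kryloff–Bogoliouboff construction (Ann. of Math. 38
(1937): invariant measures as limits of time averages) in the form used for dissipative PDE by Foias–Manley–Rosa–Temam
(*Navier–Stokes Equations and Turbulence* (2001), Ch. IV §2–§3: "time-average measures" `∫Φ dμ = LIM_{T→∞} T⁻¹∫₀ᵀ Φ(u(t)) dt`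
with a generalized (Banach) limit are invariant / stationary statistical solutions).  As in the discrete template, instead of a
weak-* accumulation point we apply the Riesz–Markov–Kakutani theorem (`RealRMK.rieszMeasure`) to the positive linear functional
`g ↦ lim_𝒰 T_k⁻¹∫₀^{T_k} g(φ_t x) dt` on `C_c(X, ℝ) = C(X, ℝ)`; invariance under `φ_s` is the vanishing of the boundary terms,
`|∫₀ᵀ g(φ_{t+s} x) dt − ∫₀ᵀ g(φ_t x) dt| = |∫_T^{T+s} − ∫₀^s| ≤ 2s·sup|g|`, and is identified on the measures by
`MeasureTheory.ext_of_forall_integral_eq_of_IsFiniteMeasure`.  Everything is proved; the generalized limit is realised by an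
ultrafilter `𝒰 ≤ atTop` chosen by the caller (so that SEVERAL observables are averaged along the SAME generalized limit — the point
of FMRT's `LIM`).  Consumer: the Navier–Stokes line `ergodic-budget-selection-closing` of `Summits/AnomalousDissipation`
(Krylov–Bogolyubov with energy/dissipation budgets on a compact phase of strong solutions).

Mathlib (this pin) has `RealRMK.rieszMeasure`, `CompactSpace (ProbabilityMeasure X)` and Birkhoff sums, but no existence theorem
for invariant measures of continuous maps or semiflows (`lean search 'Krylov|Bogol|exists_invariant'`: 0 relevant hits).

## References

* N. Kryloff, N. Bogoliouboff, *La théorie générale de la mesure dans son application à l'étude des systèmes dynamiques de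
  la mécanique non linéaire*, Ann. of Math. 38 (1937) 65–113. [KryloffBogoliouboff1937]
* C. Foias, O. Manley, R. Rosa, R. Temam, *Navier–Stokes Equations and Turbulence*, CUP (2001), Ch. IV §2.1 Def. 2.1,
  §3.1 Prop. 3.1 (time-average measures), Ch. IV §1.3 Def. 1.4 (generalized limits). [FMRTTurbulence2001]
-/

noncomputable section

open MeasureTheory Filter Set Function
open scoped Topology

namespace Literature.Dynamics.Ergodic

section Semiflow

open scoped CompactlySupported
open CompactlySupportedContinuousMap

variable {X : Type*}

/-! ## Real-variable bookkeeping of continuous-time averages -/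

/-- A time average `τ⁻¹ ∫₀^τ h` of a function bounded by `C` on `[0, τ]` is bounded by `C` (`τ > 0`). [folklore] -/
theorem abs_inv_mul_intervalIntegral_le {h : ℝ → ℝ} {C τ : ℝ} (hτ : 0 < τ)
    (hC : ∀ t ∈ Icc (0 : ℝ) τ, |h t| ≤ C) : |τ⁻¹ * ∫ t in (0 : ℝ)..τ, h t| ≤ C := by
  have hb : ∀ t ∈ Set.uIoc (0 : ℝ) τ, ‖h t‖ ≤ C := fun t ht => by
    rw [uIoc_of_le hτ.le] at ht
    exact hC t ⟨ht.1.le, ht.2⟩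
  have h1 := intervalIntegral.norm_integral_le_of_norm_le_const hb
  rw [sub_zero, abs_of_pos hτ, Real.norm_eq_abs] at h1
  rw [abs_mul, abs_inv, abs_of_pos hτ]
  calc τ⁻¹ * |∫ t in (0 : ℝ)..τ, h t| ≤ τ⁻¹ * (C * τ) := by gcongr
    _ = C := by field_simp

/-- **Vanishing boundary terms.**  For `h` continuous on `[0, ∞)` and bounded there by `C`, `s ≥ 0` and `τ > 0`:
`|τ⁻¹∫₀^τ h(t + s) dt − τ⁻¹∫₀^τ h(t) dt| ≤ 2 s C / τ`, since the difference of the integrals is `∫_τ^{τ+s} h − ∫₀^s h`.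
[folklore] -/
theorem abs_timeAverage_shift_sub_le {h : ℝ → ℝ} {C s τ : ℝ} (hcont : ContinuousOn h (Ici 0))
    (hC : ∀ t, 0 ≤ t → |h t| ≤ C) (hs : 0 ≤ s) (hτ : 0 < τ) :
    |(τ⁻¹ * ∫ t in (0 : ℝ)..τ, h (t + s)) - τ⁻¹ * ∫ t in (0 : ℝ)..τ, h t| ≤ 2 * s * C / τ := by
  have hii : ∀ a b : ℝ, 0 ≤ a → a ≤ b → IntervalIntegrable h volume a b := fun a b ha hab => by
    refine ContinuousOn.intervalIntegrable ?_
    rw [uIcc_of_le hab]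
    exact hcont.mono fun t ht => ha.trans ht.1
  -- `∫₀^τ h(t+s) = ∫ₛ^{τ+s} h = (∫₀^τ h + ∫_τ^{τ+s} h) - ∫₀^s h`
  have hshift : ∫ t in (0 : ℝ)..τ, h (t + s) = ∫ t in s..(τ + s), h t := by
    rw [intervalIntegral.integral_comp_add_right h s, zero_add]
  have hsplit₁ : (∫ t in (0 : ℝ)..s, h t) + ∫ t in s..(τ + s), h t = ∫ t in (0 : ℝ)..(τ + s), h t :=
    intervalIntegral.integral_add_adjacent_intervals (hii 0 s le_rfl hs) (hii s (τ + s) hs (by linarith))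
  have hsplit₂ : (∫ t in (0 : ℝ)..τ, h t) + ∫ t in τ..(τ + s), h t = ∫ t in (0 : ℝ)..(τ + s), h t :=
    intervalIntegral.integral_add_adjacent_intervals (hii 0 τ le_rfl hτ.le) (hii τ (τ + s) hτ.le (by linarith))
  have hdiff : (∫ t in (0 : ℝ)..τ, h (t + s)) - ∫ t in (0 : ℝ)..τ, h t =
      (∫ t in τ..(τ + s), h t) - ∫ t in (0 : ℝ)..s, h t := by
    rw [hshift]; linarith
  -- the two boundary integrals are `≤ s C` each
  have hb₁ : |∫ t in τ..(τ + s), h t| ≤ C * s := by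
    have hb : ∀ t ∈ Set.uIoc τ (τ + s), ‖h t‖ ≤ C := fun t ht => by
      rw [uIoc_of_le (by linarith)] at ht
      exact hC t (hτ.le.trans ht.1.le)
    have h1 := intervalIntegral.norm_integral_le_of_norm_le_const hb
    rwa [show τ + s - τ = s by ring, abs_of_nonneg hs, Real.norm_eq_abs] at h1
  have hb₂ : |∫ t in (0 : ℝ)..s, h t| ≤ C * s := by
    have hb : ∀ t ∈ Set.uIoc (0 : ℝ) s, ‖h t‖ ≤ C := fun t ht => by
      rw [uIoc_of_le hs] at ht
      exact hC t ht.1.le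
    have h1 := intervalIntegral.norm_integral_le_of_norm_le_const hb
    rwa [sub_zero, abs_of_nonneg hs, Real.norm_eq_abs] at h1
  rw [← mul_sub, hdiff, abs_mul, abs_inv, abs_of_pos hτ]
  calc τ⁻¹ * |(∫ t in τ..(τ + s), h t) - ∫ t in (0 : ℝ)..s, h t|
      ≤ τ⁻¹ * (C * s + C * s) := by
        gcongr
        exact (abs_sub _ _).trans (add_le_add hb₁ hb₂)
    _ = 2 * s * C / τ := by field_simp; ring

variable [MetricSpace X]

section Orbit

variable {φ : ℝ → X → X} (hcont : ContinuousOn (fun q : ℝ × X => φ q.1 q.2) (Ici 0 ×ˢ univ))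

include hcont in
/-- The trajectory `t ↦ φ_t x` of a semiflow jointly continuous on `[0,∞) × X` is continuous on `[0, ∞)`. [folklore] -/
theorem continuousOn_orbit_of_semiflow (x : X) : ContinuousOn (fun t : ℝ => φ t x) (Ici 0) := by
  have h0 : Continuous fun t : ℝ => ((t, x) : ℝ × X) := by fun_prop
  exact hcont.comp h0.continuousOn fun t ht => ⟨ht, mem_univ _⟩

include hcont in
/-- Each `φ_s`, `s ≥ 0`, is continuous. [folklore] -/
theorem continuous_semiflow_apply {s : ℝ} (hs : 0 ≤ s) : Continuous (φ s) := by
  have h0 : Continuous fun y : X => ((s, y) : ℝ × X) := by fun_prop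
  exact hcont.comp_continuous h0 fun y => ⟨hs, mem_univ _⟩

end Orbit

variable [CompactSpace X]

/-- A continuous real function on a compact space containing a point is bounded in absolute value. [folklore] -/
theorem exists_forall_abs_le_of_continuous (x : X) {g : X → ℝ} (hg : Continuous g) : ∃ C, ∀ y, |g y| ≤ C := by
  haveI : Nonempty X := ⟨x⟩
  obtain ⟨y₀, hy₀⟩ := (continuous_abs.comp hg).exists_forall_ge (by rw [Filter.cocompact_eq_bot]; exact tendsto_bot)
  exact ⟨|g y₀|, hy₀⟩

/-! ## The generalized time-average functional -/

section Functional

variable {φ : ℝ → X → X} (hcont : ContinuousOn (fun q : ℝ × X => φ q.1 q.2) (Ici 0 ×ˢ univ)) (x : X)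
  {T : ℕ → ℝ} (hTpos : ∀ k, 0 < T k)

include hcont hTpos in
/-- **The generalized time-average functional.**  Along an ultrafilter `𝒰` on `ℕ`, the time averages
`T_k⁻¹ ∫₀^{T_k} g(φ_t x) dt` of continuous `g` converge, and the limit is a positive linear functional on
`C_c(X, ℝ) = C(X, ℝ)`. [folklore] -/
theorem exists_positiveLinearMap_tendsto_timeAverage (𝒰 : Ultrafilter ℕ) :
    ∃ Λ : C_c(X, ℝ) →ₚ[ℝ] ℝ, ∀ g : C_c(X, ℝ),
      Tendsto (fun k => (T k)⁻¹ * ∫ t in (0 : ℝ)..T k, g (φ t x)) (𝒰 : Filter ℕ) (𝓝 (Λ g)) := by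
  have horb := continuousOn_orbit_of_semiflow hcont x
  -- interval integrability of `t ↦ g (φ_t x)` on `[0, T_k]`
  have hii : ∀ (g : C_c(X, ℝ)) (k : ℕ), IntervalIntegrable (fun t => g (φ t x)) volume 0 (T k) := by
    intro g k
    refine ContinuousOn.intervalIntegrable ?_
    rw [uIcc_of_le (hTpos k).le]
    exact (g.continuous.comp_continuousOn horb).mono fun t ht => ht.1
  -- the limit exists for every continuous `g`, by compactness of `[-C, C]`
  have hlim : ∀ g : C_c(X, ℝ), Tendsto (fun k => (T k)⁻¹ * ∫ t in (0 : ℝ)..T k, g (φ t x))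
      (𝒰 : Filter ℕ) (𝓝 (limUnder (𝒰 : Filter ℕ) fun k => (T k)⁻¹ * ∫ t in (0 : ℝ)..T k, g (φ t x))) := by
    intro g
    refine tendsto_nhds_limUnder ?_
    obtain ⟨C, hC⟩ := exists_forall_abs_le_of_continuous x g.continuous
    have hmem : Icc (-C) C ∈ 𝒰.map (fun k => (T k)⁻¹ * ∫ t in (0 : ℝ)..T k, g (φ t x)) :=
      Ultrafilter.mem_map.2 (Filter.Eventually.of_forall fun k =>
        abs_le.1 (abs_inv_mul_intervalIntegral_le (hTpos k) fun t _ => hC _))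
    obtain ⟨l, -, hl⟩ := isCompact_Icc.ultrafilter_le_nhds' _ hmem
    exact ⟨l, hl⟩
  refine ⟨{ toFun := fun g => limUnder (𝒰 : Filter ℕ) fun k => (T k)⁻¹ * ∫ t in (0 : ℝ)..T k, g (φ t x)
            map_add' := ?_
            map_smul' := ?_
            monotone' := ?_ }, hlim⟩
  · intro g g'
    refine tendsto_nhds_unique (hlim (g + g')) ?_
    refine ((hlim g).add (hlim g')).congr fun k => ?_
    rw [← mul_add, ← intervalIntegral.integral_add (hii g k) (hii g' k)]
    rfl
  · intro c g
    simp only [RingHom.id_apply, smul_eq_mul]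
    refine tendsto_nhds_unique (hlim (c • g)) ?_
    refine ((hlim g).const_mul c).congr fun k => ?_
    rw [mul_left_comm, ← intervalIntegral.integral_const_mul]
    rfl
  · intro g g' hle
    refine le_of_tendsto_of_tendsto' (hlim g) (hlim g') fun k => ?_
    refine mul_le_mul_of_nonneg_left ?_ (inv_nonneg.2 (hTpos k).le)
    exact intervalIntegral.integral_mono_on (hTpos k).le (hii g k) (hii g' k) fun t _ => le_def.1 hle _

end Functional

variable [MeasurableSpace X] [BorelSpace X]

/-- **Krylov–Bogolyubov along an ultrafilter, continuous time.**  Let `φ` be a semiflow on the compact metric space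
`X` — jointly continuous on `[0,∞) × X`, with `φ_{s+t} = φ_s ∘ φ_t` for `s, t ≥ 0` — and let `x ∈ X`, `T_k > 0` with
`T_k → ∞`, and `𝒰` an ultrafilter on `ℕ` finer than `atTop`.  Then there is a Borel probability measure `m` on `X`,
invariant under every `φ_s` (`s ≥ 0`), with `∫ g dm = lim_𝒰 T_k⁻¹ ∫₀^{T_k} g(φ_t x) dt` for every continuous `g` (the
`𝒰`-limit of the time-average measures of the trajectory, obtained from the Riesz–Markov–Kakutani theorem; invariance by
the vanishing boundary terms `abs_timeAverage_shift_sub_le`).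
[cite: FMRTTurbulence2001, Ch. IV §2.1 Def. 2.1 and §3.1 Prop. 3.1 (time-average measures are invariant)] -/
theorem exists_invariantMeasure_tendsto_timeAverage_semiflow {φ : ℝ → X → X}
    (hcont : ContinuousOn (fun q : ℝ × X => φ q.1 q.2) (Ici 0 ×ˢ univ))
    (hadd : ∀ s t : ℝ, 0 ≤ s → 0 ≤ t → ∀ y : X, φ (s + t) y = φ s (φ t y))
    (x : X) {T : ℕ → ℝ} (hTpos : ∀ k, 0 < T k) (hT : Tendsto T atTop atTop)
    {𝒰 : Ultrafilter ℕ} (h𝒰 : (𝒰 : Filter ℕ) ≤ atTop) :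
    ∃ m : Measure X, IsProbabilityMeasure m ∧ (∀ s : ℝ, 0 ≤ s → Measure.map (φ s) m = m) ∧
      ∀ g : X → ℝ, Continuous g →
        Tendsto (fun k => (T k)⁻¹ * ∫ t in (0 : ℝ)..T k, g (φ t x)) (𝒰 : Filter ℕ) (𝓝 (∫ y, g y ∂m)) := by
  obtain ⟨Λ, hΛ⟩ := exists_positiveLinearMap_tendsto_timeAverage hcont x hTpos 𝒰
  have horb := continuousOn_orbit_of_semiflow hcont x
  -- integrals of continuous functions against the Riesz measure are the `𝒰`-limits
  have hint : ∀ g : X → ℝ, Continuous g → Tendsto (fun k => (T k)⁻¹ * ∫ t in (0 : ℝ)..T k, g (φ t x))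
      (𝒰 : Filter ℕ) (𝓝 (∫ y, g y ∂(RealRMK.rieszMeasure Λ))) := by
    intro g hg
    let gc : C_c(X, ℝ) := ⟨⟨g, hg⟩, HasCompactSupport.of_compactSpace g⟩
    have h1 : ∫ y, g y ∂(RealRMK.rieszMeasure Λ) = Λ gc := RealRMK.integral_rieszMeasure Λ gc
    rw [h1]
    exact hΛ gc
  -- total mass one: the average of `1` is `1`
  have huniv : RealRMK.rieszMeasure Λ univ = 1 := by
    have h1 : Tendsto (fun k => (T k)⁻¹ * ∫ _t in (0 : ℝ)..T k, (1 : ℝ)) (𝒰 : Filter ℕ) (𝓝 1) := by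
      refine tendsto_const_nhds.congr fun k => ?_
      rw [intervalIntegral.integral_const, sub_zero, smul_eq_mul, mul_one, inv_mul_cancel₀ (hTpos k).ne']
    have h2 := tendsto_nhds_unique (hint _ continuous_const) h1
    simp only [integral_const, smul_eq_mul, mul_one, measureReal_def] at h2
    exact (ENNReal.toReal_eq_one_iff _).1 h2
  haveI hprob : IsProbabilityMeasure (RealRMK.rieszMeasure Λ) := ⟨huniv⟩
  refine ⟨RealRMK.rieszMeasure Λ, hprob, fun s hs => ?_, hint⟩
  -- invariance under `φ_s`: integrals of bounded continuous functions against `(φ_s)_* m` and `m` agree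
  have hφs : Continuous (φ s) := continuous_semiflow_apply hcont (s := s) hs
  refine ext_of_forall_integral_eq_of_IsFiniteMeasure fun g => ?_
  rw [integral_map hφs.measurable.aemeasurable g.continuous.aestronglyMeasurable]
  obtain ⟨C, hC⟩ := exists_forall_abs_le_of_continuous x g.continuous
  -- `g (φ_s (φ_t x)) = g (φ_{t+s} x)` for `t ≥ 0`, so the averages differ by the boundary terms only
  have hshift : ∀ k, (T k)⁻¹ * ∫ t in (0 : ℝ)..T k, g (φ s (φ t x)) =
      (T k)⁻¹ * ∫ t in (0 : ℝ)..T k, (fun t => g (φ t x)) (t + s) := by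
    intro k
    congr 1
    refine intervalIntegral.integral_congr fun t ht => ?_
    rw [uIcc_of_le (hTpos k).le] at ht
    show g (φ s (φ t x)) = g (φ (t + s) x)
    rw [add_comm, hadd s t hs ht.1]
  have h0 : Tendsto (fun k => ((T k)⁻¹ * ∫ t in (0 : ℝ)..T k, g (φ s (φ t x)))
      - (T k)⁻¹ * ∫ t in (0 : ℝ)..T k, g (φ t x)) (𝒰 : Filter ℕ) (𝓝 0) := by
    refine Tendsto.mono_left ?_ h𝒰
    have hbound : ∀ k, |((T k)⁻¹ * ∫ t in (0 : ℝ)..T k, g (φ s (φ t x)))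
        - (T k)⁻¹ * ∫ t in (0 : ℝ)..T k, g (φ t x)| ≤ 2 * s * C * (T k)⁻¹ := fun k => by
      rw [hshift k, ← div_eq_mul_inv]
      exact abs_timeAverage_shift_sub_le (g.continuous.comp_continuousOn horb) (fun t _ => hC _) hs (hTpos k)
    have hlim : Tendsto (fun k => 2 * s * C * (T k)⁻¹) atTop (𝓝 0) := by
      simpa using (tendsto_inv_atTop_zero.comp hT).const_mul (2 * s * C)
    exact squeeze_zero_norm (fun k => by rw [Real.norm_eq_abs]; exact hbound k) hlim
  have hg' := (hint g g.continuous).add h0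
  simp only [add_zero, add_sub_cancel] at hg'
  exact tendsto_nhds_unique (hint _ (g.continuous.comp hφs)) hg'

end Semiflow

end Literature.Dynamics.Ergodic

end
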